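/- EXTRA WIDTH seat `ym-line-cbag-p1-w4` (prover-ym-line-cbag-p1-w4-g13-0), LINE 7b `VolumeComparison` of route `GlueballBandRecursion`,
item ⟨stmt-QuantumFields-22957⟩ (`--supports`, helper; it closes nothing).  The explicit, UNCONDITIONAL volume-independence bounds for the tube
rate density and the thermal free-energy density on the whole strong-coupling disc — `…VolumeJetsOfLift` with the lifting identity discharged
by the LEAD's `closed_kept_div_eq` (p668304, from the width seats' support lifting).  Def-free; two corollaries. -/
import Summits.QuantumFields.YangMills.Theorems.GlueballBandRecursionVolumeJetsOfLift
import Summits.QuantumFields.YangMills.Theorems.GlueballBandRecursionColdDoublingSmallCoupling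

/-!
# Route `GlueballBandRecursion`, LINE 7b: the vacuum-energy and thermal free-energy densities of the strong-coupling torus do not feel the
# spatial volume, with the closedness rate `4a − 3`

For a compact group `G`, a continuous matrix representation `ρ`, spatial tori `(ℤ/a)³ ⊆ (ℤ/a')³` with `4 ≤ a ≤ a'`, and every complex coupling
`‖z‖ ≤ r_ρ = strongCouplingRadius ρ`:

* `norm_tubeRate_density_sub_le_pow` — **the tube-rate density is volume-independent up to `12·(‖z‖/(e·r_ρ))^{4a−3}`**:
  `‖e_{a'}(z)/a'³ − e_a(z)/a³‖ ≤ 12(‖z‖/(e r_ρ))^{4(a−1)+1}` (`e_a = Thermal.tubeRate ρ a`; at real `β`, `Re e_a(β) = log λ₊(β, a)` is the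
  logarithm of the top transfer eigenvalue — the vacuum energy of the spatial torus — so its DENSITY has finite-size corrections of the order of a
  closed surface wrapping the torus, `4a − 3` plaquettes, not of a connected set, `≈ a`);
* `norm_volumeDiscrepancy_le_pow_disc` — **the thermal free-energy density likewise**, on the WHOLE disc: `‖volumeDiscrepancy ρ a a' t z‖ ≤ 24t(‖z‖/(e r_ρ))^{4(a−1)+1}`
  for `4 ≤ t` (at real `β` the real part of `thermalLogZ ρ a t β /a³` is `log(1 + traceExcess ρ β a t)/a³`).
Both: `…VolumeJetsOfLift` (`_of_lift` versions) with `hlift := closed_kept_div_eq` (LEAD ym-line-cbag-p1 g29, `…ColdDoublingSmallCoupling`, itself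
`SupportLifting.kept_sum_tube_mul_eq` of the width seat w5 + the singleton split).  The cold twin `norm_coldVolumeDiscrepancy_le_pow` is the LEAD's; the width seat w3's `norm_volumeDiscrepancy_le_pow`
(`…ThermalJetsHold`) is the `t`-uniform half-disc version `288e·(‖z‖/(r_ρ/2))^{4a−3}` obtained through the cold jets and the Schwarz lemma.

HONEST FRAMING.  Strong-coupling statements (complex `‖z‖ ≤ r_ρ`); nothing here bears on weak coupling, on item 22957 (the band), on the
typed-window rung `ColdDoublingRecursionStrongCoupling`, or on the Yang–Mills mass gap / the summit `YangMills`.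
-/

set_option autoImplicit false

noncomputable section

open Literature.MathematicalPhysics.QuantumFieldTheory
open Literature.MathematicalPhysics.QuantumFieldTheory.Balaban1983to89.Missing

namespace Summit.QuantumFields.YangMills.Theorems.GlueballBandRecursion.Thermal

variable {G : Type*} [Group G] [TopologicalSpace G] [IsTopologicalGroup G] [CompactSpace G] [MeasurableSpace G] [BorelSpace G]
  {N : ℕ} (ρ : G →* Matrix (Fin N) (Fin N) ℂ)

/-- **The tube-rate (vacuum-energy) density does not feel the spatial volume**: for continuous `ρ`, `4 ≤ a ≤ a'` and `‖z‖ ≤ r_ρ`,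
`‖tubeRate ρ a' z/a'³ − tubeRate ρ a z/a³‖ ≤ 12·(‖z‖/(e·r_ρ))^{4(a−1)+1}`. -/
theorem norm_tubeRate_density_sub_le_pow (hρ : Continuous ρ) {a a' : ℕ} (ha : 4 ≤ a) (haa' : a ≤ a') {z : ℂ}
    (hz : ‖z‖ ≤ strongCouplingRadius ρ) :
    ‖tubeRate ρ a' z / ((a' : ℂ) ^ 3) - tubeRate ρ a z / ((a : ℂ) ^ 3)‖ ≤
      12 * (‖z‖ / (Real.exp 1 * strongCouplingRadius ρ)) ^ (4 * (a - 1) + 1) :=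
  norm_tubeRate_div_sub_le_of_lift ρ hρ (lt_of_lt_of_le (by norm_num) ha) haa' hz
    fun _ hT => closed_kept_div_eq ρ hρ ha haa' hT hz

/-- **The thermal free-energy density does not feel the spatial volume**: for continuous `ρ`, `4 ≤ a ≤ a'`, `4 ≤ t` and `‖z‖ ≤ r_ρ`,
`‖volumeDiscrepancy ρ a a' t z‖ ≤ 24t·(‖z‖/(e·r_ρ))^{4(a−1)+1}` — on the WHOLE closed strong-coupling disc, with explicit constants
(the typed stub `ThermalFreeEnergyVolumeJets` asks only for `O(z^{3a})` at `0`). -/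
theorem norm_volumeDiscrepancy_le_pow_disc (hρ : Continuous ρ) {a a' t : ℕ} (ha : 4 ≤ a) (haa' : a ≤ a') (ht : 4 ≤ t) {z : ℂ}
    (hz : ‖z‖ ≤ strongCouplingRadius ρ) :
    ‖volumeDiscrepancy ρ a a' t z‖ ≤ 24 * t * (‖z‖ / (Real.exp 1 * strongCouplingRadius ρ)) ^ (4 * (a - 1) + 1) :=
  norm_volumeDiscrepancy_le_of_lift ρ hρ (lt_of_lt_of_le (by norm_num) ha) haa' ht hz
    fun _ hT => closed_kept_div_eq ρ hρ ha haa' hT hz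

end Summit.QuantumFields.YangMills.Theorems.GlueballBandRecursion.Thermal

end
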